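import Literature.NumberTheory.Sieve.FordMaynardFragmentation
import Literature.NumberTheory.Sieve.FordMaynardFragmentationSymm
import HarnessLib

/-!
# Ford–Maynard, Theorem 6.4: the flat fragmentation integral as an iterated slice integral

Everything here is PROVED. Second file towards Theorem 6.4 of K. Ford, J. Maynard,
*On the theory of prime producing sieves* (arXiv:2407.14368): the bridge between the flat
encoding of the fragmentation operator `fragOp γ η g` of
`Literature/NumberTheory/Sieve/FordMaynardFragmentation.lean` — ONE Lebesgue integral over
`ℝ^{Fin m × Fin N}`, block `j` read off row `j` (`blockVec`, `rowOf`, `BlockCond`) — and the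
iterated product-slice integrals `multiSlice m kv ξ` of
`Literature/NumberTheory/Sieve/FordMaynardSliceBlocks.lean` (projection measures, block after
block), for which the multi-block Fubini formula `sliceIntegral_multiSlice` is available:

* index bookkeeping for the concatenation `concatBlocks` (`finSigmaFinEquiv`): the entry of a
  nested `Fin.append β' v` at the position of the `i`-th element of the last / an earlier block
  (`append_apply_cast_finSigmaFinEquiv_last`, `append_apply_cast_finSigmaFinEquiv_castSucc`),
  whence the product of block weights peels (`prod_blockWeight_append`);
* measurability of the flat integrand, its boundedness and bounded support, integrability;
* `exists_rowPeel`: `ℝ^{Fin (m+1) × Fin N} ≅ ℝ^{Fin m × Fin N} × ℝ^{Fin N}` (last row split off),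
  measure preserving; `integral_row_eq_sliceIntegral`: integrating an admissible block over its
  row is the slice integral (the `N − k + 1` dummy coordinates integrate to `1`);
* **`flat_eq_multiSlice`** (Fubini, row by row) and **`fragOp_eq_multiSlice`**:
  `fragOp γ η g (ξ) = ξ₁⋯ξ_m ∑_{1 ≤ k_j ≤ N} multiSlice m k ξ (β ↦ 𝟙[β ≥ η] ∏_j w(β_j) g(β))`,
  i.e. the printed iterated form (6.3) of the fragmentation operator.

Implementation note. `bsum (m+1) kv` and `bsum m (Fin.init kv) + kv (Fin.last m)` (likewise
`Fin.init kv j` and `kv (Fin.castSucc j)`) agree only up to unfolding; statements below are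
phrased so that the implicit dimension arguments are the ones produced by `multiSlice_succ` and
β-reduction (casts `Fin.cast (bsum_eq_sum (m+1) kv).symm` elaborated without expected type), and
evaluations of `Fin.append` are done through the value-based helpers `append_apply_eq_*_of_val`.

## References

* K. Ford, J. Maynard, *On the theory of prime producing sieves*, arXiv:2407.14368 (2024), §4.2
  (projection measures), §6.1 (6.3). [FordMaynard2024PrimeSieves]
-/

noncomputable section

open MeasureTheory Finset
open scoped Classical

namespace Literature.NumberTheory.Sieve.FordMaynard

/-! ### Index bookkeeping for `finSigmaFinEquiv` and nested `Fin.append` -/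

/-- Position of the `i`-th entry of the last block. [folklore] -/
theorem val_finSigmaFinEquiv_last {m : ℕ} (kv : Fin (m + 1) → ℕ) (i : Fin (kv (Fin.last m))) :
    (finSigmaFinEquiv (n := kv) ⟨Fin.last m, i⟩ : ℕ) = (∑ j : Fin m, kv (Fin.castSucc j)) + i := by
  rw [finSigmaFinEquiv_apply]
  rfl

/-- Position of the `i`-th entry of an earlier block is its position for the initial blocks.
[folklore] -/
theorem val_finSigmaFinEquiv_castSucc {m : ℕ} (kv : Fin (m + 1) → ℕ) (j : Fin m)
    (i : Fin (kv (Fin.castSucc j))) :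
    (finSigmaFinEquiv (n := kv) ⟨Fin.castSucc j, i⟩ : ℕ) =
      (finSigmaFinEquiv (n := Fin.init kv) ⟨j, i⟩ : ℕ) := by
  rw [finSigmaFinEquiv_apply, finSigmaFinEquiv_apply]
  rfl

/-- `Fin.append u v x = v i` as soon as `x` sits at position `a + i`. [folklore] -/
theorem append_apply_eq_right_of_val {a b : ℕ} (u : Fin a → ℝ) (v : Fin b → ℝ) (x : Fin (a + b))
    (i : Fin b) (hx : (x : ℕ) = a + i) : Fin.append u v x = v i := by
  have : x = Fin.natAdd a i := Fin.ext (by simpa using hx)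
  subst this
  exact Fin.append_right u v i

/-- `Fin.append u v x = u l` as soon as `x` sits at position `l`. [folklore] -/
theorem append_apply_eq_left_of_val {a b : ℕ} (u : Fin a → ℝ) (v : Fin b → ℝ) (x : Fin (a + b))
    (l : Fin a) (hx : (x : ℕ) = l) : Fin.append u v x = u l := by
  have : x = Fin.castAdd b l := Fin.ext (by simpa using hx)
  subst this
  exact Fin.append_left u v l

/-- Nested appends at two positions with the same value agree (absorbing casts of the first
block). [folklore] -/
theorem append_comp_cast_apply_eq {a a' b : ℕ} (u : Fin a → ℝ) (v : Fin b → ℝ) (h : a' = a)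
    (x : Fin (a' + b)) (y : Fin (a + b)) (hxy : (x : ℕ) = y) :
    Fin.append (u ∘ Fin.cast h) v x = Fin.append u v y := by
  subst h
  have : x = y := Fin.ext hxy
  subst this
  rfl

/-- In a nested `Fin.append β' v` (`β'` the first `m` blocks, `v` the last block), the entry at
the position of the `i`-th element of the last block is `v i`. [folklore] -/
theorem append_apply_cast_finSigmaFinEquiv_last {m : ℕ} (kv : Fin (m + 1) → ℕ)
    (β' : Fin (bsum m (Fin.init kv)) → ℝ) (v : Fin (kv (Fin.last m)) → ℝ) (i : Fin (kv (Fin.last m))) :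
    Fin.append β' v (@Fin.cast _ (bsum (m + 1) kv) (bsum_eq_sum (m + 1) kv).symm
        (finSigmaFinEquiv (n := kv) ⟨Fin.last m, i⟩)) = v i := by
  refine append_apply_eq_right_of_val β' v _ i ?_
  simp only [Fin.val_cast, val_finSigmaFinEquiv_last, bsum_eq_sum]
  rfl

/-- In a nested `Fin.append β' v`, the entry at the position of the `i`-th element of block
`j < m` is the corresponding entry of `β'`. [folklore] -/
theorem append_apply_cast_finSigmaFinEquiv_castSucc {m : ℕ} (kv : Fin (m + 1) → ℕ)
    (β' : Fin (bsum m (Fin.init kv)) → ℝ) (v : Fin (kv (Fin.last m)) → ℝ) (j : Fin m)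
    (i : Fin (kv (Fin.castSucc j))) :
    Fin.append β' v (@Fin.cast _ (bsum (m + 1) kv) (bsum_eq_sum (m + 1) kv).symm
        (finSigmaFinEquiv (n := kv) ⟨Fin.castSucc j, i⟩)) =
      β' (Fin.cast (bsum_eq_sum m (Fin.init kv)).symm (finSigmaFinEquiv (n := Fin.init kv) ⟨j, i⟩)) := by
  refine append_apply_eq_left_of_val β' v _ _ ?_
  simp only [Fin.val_cast, val_finSigmaFinEquiv_castSucc]

/-- **Peeling the product of block weights**: for `β = (β', v)`,
`∏_{j ≤ m} w_{k_j}(β_j) = (∏_{j < m} w_{k_j}(β'_j)) · w_{k_m}(v)`. [folklore] -/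
theorem prod_blockWeight_append (γ : ℝ) {m : ℕ} (kv : Fin (m + 1) → ℕ)
    (β' : Fin (bsum m (Fin.init kv)) → ℝ) (v : Fin (kv (Fin.last m)) → ℝ) :
    (∏ j : Fin (m + 1), blockWeight γ (kv j) (fun i => Fin.append β' v
        (@Fin.cast _ (bsum (m + 1) kv) (bsum_eq_sum (m + 1) kv).symm
          (finSigmaFinEquiv (n := kv) ⟨j, i⟩)))) =
      (∏ j : Fin m, blockWeight γ (Fin.init kv j) (fun i =>
          β' (Fin.cast (bsum_eq_sum m (Fin.init kv)).symm (finSigmaFinEquiv (n := Fin.init kv) ⟨j, i⟩)))) *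
        blockWeight γ (kv (Fin.last m)) v := by
  rw [Fin.prod_univ_castSucc]
  congr 1
  · refine Finset.prod_congr rfl fun j _ => ?_
    show blockWeight γ (kv (Fin.castSucc j)) _ = blockWeight γ (kv (Fin.castSucc j)) _
    congr 1
    funext i
    exact append_apply_cast_finSigmaFinEquiv_castSucc kv β' v j i
  · congr 1
    funext i
    exact append_apply_cast_finSigmaFinEquiv_last kv β' v i

/-! ### Measurability and integrability of the flat integrand -/

/-- `U ↦ rowOf U j i` is measurable. [folklore] -/
theorem measurable_rowOf {m N : ℕ} (j : Fin m) (i : ℕ) :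
    Measurable fun U : Fin m × Fin N → ℝ => rowOf U j i := by
  unfold rowOf
  by_cases h : i < N
  · simp only [h, dif_pos]; exact measurable_pi_apply _
  · simp only [h, dif_neg, not_false_eq_true]; exact measurable_const

/-- `x ↦ blockVec k α (u x)` is measurable if every coordinate of `u` is. [folklore] -/
theorem measurable_blockVec_comp {X : Type*} [MeasurableSpace X] (k : ℕ) (α : ℝ) {u : X → ℕ → ℝ}
    (hu : ∀ i, Measurable fun x => u x i) : Measurable fun x => blockVec k α (u x) := by
  refine measurable_pi_iff.2 fun i => ?_
  unfold blockVec
  split_ifs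
  · exact hu i
  · exact measurable_const.sub (Finset.measurable_sum _ fun i' _ => hu i')

/-- The admissibility condition `BlockCond` is a measurable predicate of the row. [folklore] -/
theorem measurable_blockCond {X : Type*} [MeasurableSpace X] (η : ℝ) (N k : ℕ) (α : ℝ)
    {u : X → ℕ → ℝ} (hu : ∀ i, Measurable fun x => u x i) :
    Measurable fun x => BlockCond η N k α (u x) := by
  unfold BlockCond
  refine Measurable.and ?_ (Measurable.and ?_ (Measurable.and ?_ ?_))
  · exact Measurable.forall fun i => measurable_const.imp
      (measurableSet_setOf.1 (measurableSet_lt measurable_const (hu i)))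
  · exact measurableSet_setOf.1
      (measurableSet_lt (Finset.measurable_sum _ fun i _ => hu i) measurable_const)
  · exact Measurable.forall fun i => measurable_const.imp (measurable_const.imp
      ((measurableSet_setOf.1 (measurableSet_lt measurable_const (hu i))).and
        (measurableSet_setOf.1 (measurableSet_lt (hu i) measurable_const))))
  · exact Measurable.forall fun i => measurableSet_setOf.1 (measurableSet_le measurable_const
      ((measurable_pi_apply i).comp (measurable_blockVec_comp k α hu)))

/-- The concatenation of the blocks read off `U` is measurable in `U`. [folklore] -/
theorem measurable_concatBlocks_blockVec {m N : ℕ} (kv : Fin m → ℕ) (ξ : Fin m → ℝ) :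
    Measurable fun U : Fin m × Fin N → ℝ =>
      concatBlocks kv (fun j => blockVec (kv j) (ξ j) (rowOf U j)) := by
  refine measurable_pi_iff.2 fun t => ?_
  obtain ⟨p, rfl⟩ := (finSigmaFinEquiv (n := kv)).surjective t
  simp_rw [concatBlocks_apply_equiv]
  exact (measurable_pi_apply p.2).comp (measurable_blockVec_comp _ _ (measurable_rowOf p.1))

/-- The flat integrand `𝟙[all blocks admissible] · H(concatenated blocks)` is measurable.
[folklore] -/
theorem measurable_flatIntegrand {m N : ℕ} (η : ℝ) (kv : Fin m → ℕ) (ξ : Fin m → ℝ)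
    {H : (Fin (∑ j, kv j) → ℝ) → ℝ} (hH : Measurable H) :
    Measurable fun U : Fin m × Fin N → ℝ =>
      if ∀ j, BlockCond η N (kv j) (ξ j) (rowOf U j) then
        H (concatBlocks kv fun j => blockVec (kv j) (ξ j) (rowOf U j)) else 0 := by
  refine Measurable.ite ?_ (hH.comp (measurable_concatBlocks_blockVec kv ξ)) measurable_const
  exact (Measurable.forall fun j =>
    measurable_blockCond η N (kv j) (ξ j) (measurable_rowOf j)).setOf

/-- Under `BlockCond`, the entries of the concatenated blocks are `≥ η`. [folklore] -/
theorem le_concatBlocks_of_blockCond {m N : ℕ} {η : ℝ} {kv : Fin m → ℕ} {ξ : Fin m → ℝ}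
    {U : Fin m × Fin N → ℝ} (hc : ∀ j, BlockCond η N (kv j) (ξ j) (rowOf U j))
    (t : Fin (∑ j, kv j)) :
    η ≤ concatBlocks kv (fun j => blockVec (kv j) (ξ j) (rowOf U j)) t := by
  obtain ⟨p, rfl⟩ := (finSigmaFinEquiv (n := kv)).surjective t
  rw [concatBlocks_apply_equiv]
  exact (hc p.1).le_blockVec p.2

/-- Under `BlockCond`, every flat coordinate lies in `(0, 1 + ∑ |ξ_j|)`. [folklore] -/
theorem mem_Ioo_of_blockCond {m N : ℕ} {η : ℝ} {kv : Fin m → ℕ}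
    {ξ : Fin m → ℝ} {U : Fin m × Fin N → ℝ} (hc : ∀ j, BlockCond η N (kv j) (ξ j) (rowOf U j))
    (q : Fin m × Fin N) : U q ∈ Set.Ioo 0 (1 + ∑ j, |ξ j|) := by
  obtain ⟨j, i⟩ := q
  obtain ⟨h1, h2, h3, -⟩ := hc j
  have hrow : rowOf U j i = U (j, i) := by simp [rowOf, i.2]
  have hξ : ξ j ≤ ∑ j', |ξ j'| :=
    (le_abs_self _).trans (Finset.single_le_sum (fun j' _ => abs_nonneg (ξ j')) (Finset.mem_univ j))
  by_cases hi : (i : ℕ) + 1 < kv j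
  · have hpos := h1 i hi
    have hle : rowOf U j i ≤ ∑ i' ∈ Finset.range (kv j - 1), rowOf U j i' :=
      Finset.single_le_sum (f := fun i' => rowOf U j i')
        (fun i' hi' => (h1 i' (by have := Finset.mem_range.1 hi'; omega)).le)
        (Finset.mem_range.2 (by omega))
    rw [hrow] at hpos hle
    exact ⟨hpos, by linarith⟩
  · have := h3 i (by omega) i.2
    rw [hrow] at this
    have h0 : 0 ≤ ∑ j', |ξ j'| := Finset.sum_nonneg fun j' _ => abs_nonneg _
    exact ⟨this.1, by linarith [this.2]⟩

/-- The flat integrand is integrable (bounded, measurable, with bounded support). [folklore] -/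
theorem integrable_flatIntegrand {m N : ℕ} {η : ℝ} (kv : Fin m → ℕ)
    (ξ : Fin m → ℝ) {H : (Fin (∑ j, kv j) → ℝ) → ℝ} (hH : Measurable H) {C : ℝ} (hC : 0 ≤ C)
    (hHb : ∀ β, (∀ t, η ≤ β t) → |H β| ≤ C) :
    Integrable fun U : Fin m × Fin N → ℝ =>
      if ∀ j, BlockCond η N (kv j) (ξ j) (rowOf U j) then
        H (concatBlocks kv fun j => blockVec (kv j) (ξ j) (rowOf U j)) else 0 := by
  set R : ℝ := 1 + ∑ j, |ξ j| with hR
  have hsupp : Function.support (fun U : Fin m × Fin N → ℝ =>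
      if ∀ j, BlockCond η N (kv j) (ξ j) (rowOf U j) then
        H (concatBlocks kv fun j => blockVec (kv j) (ξ j) (rowOf U j)) else 0) ⊆
      Set.pi Set.univ fun _ => Set.Icc 0 R := by
    intro U hU
    rw [Function.mem_support] at hU
    have hc : ∀ j, BlockCond η N (kv j) (ξ j) (rowOf U j) := by
      by_contra h
      exact hU (if_neg h)
    simp only [Set.mem_pi, Set.mem_univ, Set.mem_Icc, forall_true_left]
    intro q
    have := mem_Ioo_of_blockCond hc q
    exact ⟨this.1.le, this.2.le⟩
  rw [← integrableOn_iff_integrable_of_support_subset hsupp]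
  have hfin : volume (Set.pi Set.univ fun _ : Fin m × Fin N => Set.Icc (0 : ℝ) R) < ⊤ := by
    rw [Set.pi_univ_Icc]
    exact isCompact_Icc.measure_lt_top
  refine Measure.integrableOn_of_bounded (M := C) hfin.ne
    (measurable_flatIntegrand η kv ξ hH).aestronglyMeasurable ?_
  refine Filter.Eventually.of_forall fun U => ?_
  rw [Real.norm_eq_abs]
  split_ifs with hc
  · exact hHb _ (le_concatBlocks_of_blockCond hc)
  · rw [abs_zero]; exact hC

/-! ### Splitting off the last row -/

/-- **Splitting off the last row**: a measure-preserving identification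
`ℝ^{Fin (m+1) × Fin N} ≅ ℝ^{Fin m × Fin N} × ℝ^{Fin N}` under which rows `j < m` go to the first
factor and row `m` to the second. [folklore] -/
theorem exists_rowPeel (m N : ℕ) :
    ∃ Ψ : (Fin (m + 1) × Fin N → ℝ) ≃ᵐ (Fin m × Fin N → ℝ) × (Fin N → ℝ),
      MeasurePreserving Ψ volume volume ∧
      ∀ (V : Fin m × Fin N → ℝ) (w : Fin N → ℝ),
        (∀ (j : Fin m) (i : Fin N), Ψ.symm (V, w) (Fin.castSucc j, i) = V (j, i)) ∧
        ∀ i : Fin N, Ψ.symm (V, w) (Fin.last m, i) = w i := by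
  let e : (Fin m × Fin N) ⊕ Fin N ≃ Fin (m + 1) × Fin N :=
    { toFun := Sum.elim (fun p => (Fin.castSucc p.1, p.2)) (fun i => (Fin.last m, i))
      invFun := fun q => Fin.lastCases (motive := fun _ => (Fin m × Fin N) ⊕ Fin N)
        (Sum.inr q.2) (fun j => Sum.inl (j, q.2)) q.1
      left_inv := by
        rintro (⟨j, i⟩ | i)
        · simp
        · simp
      right_inv := by
        rintro ⟨q1, q2⟩
        induction q1 using Fin.lastCases with
        | last => simp
        | cast j => simp }
  let Ψ : (Fin (m + 1) × Fin N → ℝ) ≃ᵐ (Fin m × Fin N → ℝ) × (Fin N → ℝ) :=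
    (MeasurableEquiv.piCongrLeft (fun _ => ℝ) e).symm.trans
      (MeasurableEquiv.sumPiEquivProdPi fun _ => ℝ)
  have hΨ : ∀ U : Fin (m + 1) × Fin N → ℝ,
      Ψ U = (fun p => U (Fin.castSucc p.1, p.2), fun i => U (Fin.last m, i)) := fun U => rfl
  refine ⟨Ψ, ?_, fun V w => ?_⟩
  · exact (volume_measurePreserving_sumPiEquivProdPi fun _ : (Fin m × Fin N) ⊕ Fin N => ℝ).comp
      ((volume_measurePreserving_piCongrLeft (fun _ => ℝ) e).symm _)
  · have h := hΨ (Ψ.symm (V, w))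
    rw [MeasurableEquiv.apply_symm_apply, Prod.ext_iff] at h
    obtain ⟨h1, h2⟩ := h
    exact ⟨fun j i => (congr_fun h1 (j, i)).symm, fun i => (congr_fun h2 i).symm⟩

/-! ### Integrating one block over its row -/

/-- **Integrating an admissible block over its row is a slice integral.** For `1 ≤ k ≤ N`,
`∫_{w ∈ ℝ^N} 𝟙[BlockCond](w) K(blockVec k α w) dw = ∫_{v ∈ Δ_k(α)} 𝟙[v ≥ η] K(v) dv`: the first
`k − 1` coordinates parametrise the slice, the remaining `N − k + 1` dummy coordinates range over
`(0, 1)` and integrate to `1`. [cite: FordMaynard2024PrimeSieves, §4.2 (projection measures)] -/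
theorem integral_row_eq_sliceIntegral {N k : ℕ} (hk : 1 ≤ k) (hkN : k ≤ N) (η α : ℝ)
    (K : (Fin k → ℝ) → ℝ) :
    ∫ w : Fin N → ℝ, (if BlockCond η N k α (fun i => if h : i < N then w ⟨i, h⟩ else 0) then
        K (blockVec k α fun i => if h : i < N then w ⟨i, h⟩ else 0) else 0) =
      sliceIntegral k α (fun v => if ∀ i, η ≤ v i then K v else 0) := by
  obtain ⟨d, rfl⟩ : ∃ d, k = d + 1 := ⟨k - 1, by omega⟩
  have hdN : d + (N - d) = N := by omega
  -- split the row into the `d` free coordinates and the `N - d` dummies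
  let e : Fin d ⊕ Fin (N - d) ≃ Fin N := finSumFinEquiv.trans (finCongr hdN)
  let Φ : (Fin N → ℝ) ≃ᵐ (Fin d → ℝ) × (Fin (N - d) → ℝ) :=
    (MeasurableEquiv.piCongrLeft (fun _ => ℝ) e).symm.trans
      (MeasurableEquiv.sumPiEquivProdPi fun _ => ℝ)
  have hΦ : MeasurePreserving Φ volume volume :=
    (volume_measurePreserving_sumPiEquivProdPi fun _ : Fin d ⊕ Fin (N - d) => ℝ).comp
      ((volume_measurePreserving_piCongrLeft (fun _ => ℝ) e).symm _)
  have hΦapply : ∀ w : Fin N → ℝ, Φ w = (fun i => w (e (Sum.inl i)), fun i => w (e (Sum.inr i))) :=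
    fun w => rfl
  have hΦsymm : ∀ (u : Fin d → ℝ) (z : Fin (N - d) → ℝ),
      (∀ i, Φ.symm (u, z) (e (Sum.inl i)) = u i) ∧ ∀ i, Φ.symm (u, z) (e (Sum.inr i)) = z i := by
    intro u z
    have h := hΦapply (Φ.symm (u, z))
    rw [MeasurableEquiv.apply_symm_apply, Prod.ext_iff] at h
    exact ⟨fun i => (congr_fun h.1 i).symm, fun i => (congr_fun h.2 i).symm⟩
  have he_inl : ∀ i : Fin d, ((e (Sum.inl i) : Fin N) : ℕ) = i := fun i => by simp [e]
  have he_inr : ∀ i : Fin (N - d), ((e (Sum.inr i) : Fin N) : ℕ) = d + i := fun i => by simp [e]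
  -- the row read off `Φ.symm (u, z)`
  set row : (Fin N → ℝ) → ℕ → ℝ := fun w i => if h : i < N then w ⟨i, h⟩ else 0 with hrow
  have hrow_lt : ∀ u z (i : Fin d), row (Φ.symm (u, z)) i = u i := by
    intro u z i
    have hi : (i : ℕ) < N := by omega
    have h1 : row (Φ.symm (u, z)) i = Φ.symm (u, z) ⟨i, hi⟩ := by simp only [hrow, hi, dif_pos]
    have h2 : (⟨i, hi⟩ : Fin N) = e (Sum.inl i) := Fin.ext (he_inl i).symm
    rw [h1, h2]
    exact (hΦsymm u z).1 i
  have hrow_ge : ∀ u z (i : Fin (N - d)), row (Φ.symm (u, z)) (d + i) = z i := by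
    intro u z i
    have hi : d + (i : ℕ) < N := by omega
    have h1 : row (Φ.symm (u, z)) (d + i) = Φ.symm (u, z) ⟨d + i, hi⟩ := by
      simp only [hrow, hi, dif_pos]
    have h2 : (⟨d + i, hi⟩ : Fin N) = e (Sum.inr i) := Fin.ext (he_inr i).symm
    rw [h1, h2]
    exact (hΦsymm u z).2 i
  have hbv : ∀ u z, blockVec (d + 1) α (row (Φ.symm (u, z))) = Fin.snoc u (α - ∑ i, u i) := by
    intro u z
    funext i
    unfold blockVec
    refine Fin.lastCases ?_ (fun i' => ?_) i
    · simp only [Fin.val_last, lt_self_iff_false, if_false, Fin.snoc_last, Nat.add_sub_cancel]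
      rw [← Fin.sum_univ_eq_sum_range (fun i => row (Φ.symm (u, z)) i) d]
      exact congrArg (α - ·) (Finset.sum_congr rfl fun i _ => hrow_lt u z i)
    · simp only [Fin.val_castSucc, add_lt_add_iff_right, Fin.is_lt, if_true, Fin.snoc_castSucc]
      exact hrow_lt u z i'
  -- the admissibility condition splits into a condition on `u` and one on `z`
  have hcond : ∀ u z, BlockCond η N (d + 1) α (row (Φ.symm (u, z))) ↔
      (((∀ i, 0 < u i) ∧ ∑ i, u i < α) ∧ ∀ i, η ≤ (Fin.snoc u (α - ∑ i, u i) : Fin (d + 1) → ℝ) i) ∧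
        ∀ i : Fin (N - d), 0 < z i ∧ z i < 1 := by
    intro u z
    unfold BlockCond
    rw [hbv u z, Nat.add_sub_cancel,
      ← Fin.sum_univ_eq_sum_range (fun i => row (Φ.symm (u, z)) i) d]
    simp only [Finset.sum_congr rfl fun (i : Fin d) (_ : i ∈ Finset.univ) => hrow_lt u z i]
    constructor
    · rintro ⟨h1, h2, h3, h4⟩
      refine ⟨⟨⟨fun i => ?_, h2⟩, h4⟩, fun i => ?_⟩
      · have := h1 i (by omega); rwa [hrow_lt u z i] at this
      · have := h3 (d + i) (by omega) (by omega); rwa [hrow_ge u z i] at this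
    · rintro ⟨⟨⟨h1, h2⟩, h4⟩, h3⟩
      refine ⟨fun i hi => ?_, h2, fun i hi hiN => ?_, h4⟩
      · have := h1 ⟨i, by omega⟩; rwa [← hrow_lt u z ⟨i, by omega⟩] at this
      · obtain ⟨i', rfl⟩ : ∃ i' : ℕ, i = d + i' := ⟨i - d, by omega⟩
        have := h3 ⟨i', by omega⟩; rwa [← hrow_ge u z ⟨i', by omega⟩] at this
  -- change variables and factorise
  set A : (Fin d → ℝ) → ℝ := fun u =>
    if ((∀ i, 0 < u i) ∧ ∑ i, u i < α) ∧ ∀ i, η ≤ (Fin.snoc u (α - ∑ i, u i) : Fin (d + 1) → ℝ) i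
    then K (Fin.snoc u (α - ∑ i, u i)) else 0 with hA
  set B : (Fin (N - d) → ℝ) → ℝ := fun z => if ∀ i : Fin (N - d), 0 < z i ∧ z i < 1 then 1 else 0
    with hB
  have hpt : ∀ p : (Fin d → ℝ) × (Fin (N - d) → ℝ),
      (if BlockCond η N (d + 1) α (row (Φ.symm p)) then K (blockVec (d + 1) α (row (Φ.symm p)))
        else 0) = A p.1 * B p.2 := by
    rintro ⟨u, z⟩
    simp only [hA, hB]
    rw [hbv u z]
    by_cases hz : ∀ i : Fin (N - d), 0 < z i ∧ z i < 1
    · rw [if_pos hz, mul_one]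
      by_cases hu : ((∀ i, 0 < u i) ∧ ∑ i, u i < α) ∧
          ∀ i, η ≤ (Fin.snoc u (α - ∑ i, u i) : Fin (d + 1) → ℝ) i
      · rw [if_pos hu, if_pos ((hcond u z).2 ⟨hu, hz⟩)]
      · rw [if_neg hu, if_neg (fun h => hu ((hcond u z).1 h).1)]
    · rw [if_neg hz, mul_zero, if_neg (fun h => hz ((hcond u z).1 h).2)]
  have hchange : ∫ w : Fin N → ℝ, (if BlockCond η N (d + 1) α (row w) then
      K (blockVec (d + 1) α (row w)) else 0) =
      ∫ p : (Fin d → ℝ) × (Fin (N - d) → ℝ), (if BlockCond η N (d + 1) α (row (Φ.symm p)) then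
        K (blockVec (d + 1) α (row (Φ.symm p))) else 0) :=
    (hΦ.symm.integral_comp' (f := Φ.symm) (fun w => if BlockCond η N (d + 1) α (row w) then
      K (blockVec (d + 1) α (row w)) else 0)).symm
  rw [hchange, integral_congr_ae (Filter.Eventually.of_forall hpt),
    show (volume : Measure ((Fin d → ℝ) × (Fin (N - d) → ℝ))) = volume.prod volume from rfl,
    integral_prod_mul (μ := volume) (ν := volume) A B]
  -- the dummies integrate to one
  have hBint : ∫ z, B z = 1 := by
    have hBind : B = (Set.univ.pi fun _ : Fin (N - d) => Set.Ioo (0 : ℝ) 1).indicator fun _ => 1 := by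
      funext z
      simp only [hB, Set.indicator, Set.mem_univ_pi, Set.mem_Ioo]
    rw [hBind, integral_indicator_const _ (MeasurableSet.univ_pi fun _ => measurableSet_Ioo),
      measureReal_def, volume_pi_pi]
    simp
  rw [hBint, mul_one]
  -- the free coordinates give the slice integral
  rw [sliceIntegral_succ_eq]
  refine integral_congr_ae (Filter.Eventually.of_forall fun u => ?_)
  simp only [hA]
  unfold sliceIntegrand
  beta_reduce
  by_cases hu : (∀ i, 0 < u i) ∧ ∑ i, u i < α
  · by_cases hη' : ∀ i, η ≤ (Fin.snoc u (α - ∑ i, u i) : Fin (d + 1) → ℝ) i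
    · rw [if_pos ⟨hu, hη'⟩, if_pos hu, if_pos hη']
    · rw [if_neg (fun h => hη' h.2), if_pos hu, if_neg hη']
  · rw [if_neg (fun h => hu h.1), if_neg hu]

/-! ### The flat integral is the iterated slice integral -/

/-- **Row-by-row Fubini**: the flat fragmentation integral with integrand `H` of the concatenated
blocks equals the iterated product-slice integral `multiSlice m kv ξ` of `𝟙[β ≥ η] H(β)`
(`1 ≤ k_j ≤ N`, `H` bounded measurable on the vectors with entries `≥ η`).
[cite: FordMaynard2024PrimeSieves, §6.1 (6.3)] -/
theorem flat_eq_multiSlice {N : ℕ} {η : ℝ} (hη : 0 < η) :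
    ∀ (m : ℕ) (kv : Fin m → ℕ), (∀ j, 1 ≤ kv j ∧ kv j ≤ N) → ∀ (ξ : Fin m → ℝ)
      (H : (Fin (∑ j, kv j) → ℝ) → ℝ), Measurable H → ∀ {C : ℝ}, 0 ≤ C →
      (∀ β, (∀ t, η ≤ β t) → |H β| ≤ C) →
      ∫ U : Fin m × Fin N → ℝ, (if ∀ j, BlockCond η N (kv j) (ξ j) (rowOf U j) then
          H (concatBlocks kv fun j => blockVec (kv j) (ξ j) (rowOf U j)) else 0) =
        multiSlice m kv ξ (fun β => if ∀ t, η ≤ β t then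
          H (β ∘ Fin.cast (bsum_eq_sum m kv).symm) else 0)
  | 0, kv, _, ξ, H, _, C, _, _ => by
    rw [multiSlice_zero, Measure.volume_pi_eq_dirac (fun _ => (0 : ℝ)), integral_dirac]
    have h0 : ∑ j : Fin 0, kv j = 0 := by simp
    have hR : ∀ t : Fin (bsum 0 kv), η ≤ (Fin.elim0 : Fin 0 → ℝ) t := fun t => t.elim0
    rw [if_pos hR]
    have hL : ∀ j : Fin 0, BlockCond η N (kv j) (ξ j) (rowOf (fun _ : Fin 0 × Fin N => (0 : ℝ)) j) :=
      fun j => j.elim0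
    rw [if_pos hL]
    congr 1
    funext t
    exact (Fin.cast h0 t).elim0
  | m + 1, kv, hkv, ξ, H, hH, C, hC, hHb => by
    obtain ⟨Ψ, hΨ, hΨs⟩ := exists_rowPeel m N
    have hsum : ∑ j, kv j = (∑ j : Fin m, Fin.init kv j) + kv (Fin.last m) :=
      Fin.sum_univ_castSucc kv
    -- the integrand
    set Z : (Fin (m + 1) × Fin N → ℝ) → ℝ := fun U =>
      if ∀ j, BlockCond η N (kv j) (ξ j) (rowOf U j) then
        H (concatBlocks kv fun j => blockVec (kv j) (ξ j) (rowOf U j)) else 0 with hZ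
    have hZint : Integrable Z := integrable_flatIntegrand kv ξ hH hC hHb
    -- the inner integrand for the remaining rows
    set H' : (Fin (∑ j : Fin m, Fin.init kv j) → ℝ) → ℝ := fun β' =>
      sliceIntegral (kv (Fin.last m)) (ξ (Fin.last m)) (fun v => if ∀ i, η ≤ v i then
        H (Fin.append β' v ∘ Fin.cast hsum) else 0) with hH'
    have hH'm : Measurable H' := by
      refine measurable_sliceIntegral_param (X := Fin (∑ j : Fin m, Fin.init kv j) → ℝ)
        (kv (Fin.last m)) measurable_const ?_
      refine Measurable.ite ?_ ?_ measurable_const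
      · refine (Measurable.forall fun i => ?_).setOf
        have hm2 : Measurable fun q : (Fin (∑ j : Fin m, Fin.init kv j) → ℝ) ×
            (Fin (kv (Fin.last m)) → ℝ) => q.2 i := (measurable_pi_apply i).comp measurable_snd
        exact measurableSet_setOf.1 (measurableSet_le measurable_const hm2)
      · exact hH.comp ((measurable_pi_iff.2 fun t => measurable_pi_apply _).comp measurable_finAppend)
    have hH'b : ∀ β', (∀ t, η ≤ β' t) →
        |H' β'| ≤ C * max (ξ (Fin.last m)) 1 ^ kv (Fin.last m) := by
      intro β' hβ'
      refine abs_sliceIntegral_le_pow _ (le_max_right _ _) (le_max_left _ _) hC fun v => ?_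
      split_ifs with hv
      · refine hHb _ fun t => ?_
        simp only [Function.comp_apply]
        obtain ⟨x, hx⟩ : ∃ x, Fin.cast hsum t = x := ⟨_, rfl⟩
        rw [hx]
        refine Fin.addCases (fun l => ?_) (fun r => ?_) x
        · rw [Fin.append_left]; exact hβ' l
        · rw [Fin.append_right]; exact hv r
      · rw [abs_zero]; exact hC
    -- rows of `Ψ.symm (V, w)`
    have hrow_cast : ∀ V w (j : Fin m), rowOf (Ψ.symm (V, w)) (Fin.castSucc j) = rowOf V j := by
      intro V w j
      funext i
      unfold rowOf
      split_ifs with hi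
      · exact (hΨs V w).1 j ⟨i, hi⟩
      · rfl
    have hrow_last : ∀ V w, rowOf (Ψ.symm (V, w)) (Fin.last m) =
        fun i => if h : i < N then w ⟨i, h⟩ else 0 := by
      intro V w
      funext i
      unfold rowOf
      split_ifs with hi
      · exact (hΨs V w).2 ⟨i, hi⟩
      · rfl
    -- Fubini
    have h1 : ∫ U, Z U = ∫ p, Z (Ψ.symm p) := (hΨ.symm.integral_comp' (f := Ψ.symm) Z).symm
    have h2 : ∫ p, Z (Ψ.symm p) = ∫ V, ∫ w, Z (Ψ.symm (V, w)) := by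
      rw [show (volume : Measure ((Fin m × Fin N → ℝ) × (Fin N → ℝ))) = volume.prod volume from rfl]
      refine integral_prod _ ?_
      exact (hΨ.symm.integrable_comp_emb Ψ.symm.measurableEmbedding).2 hZint
    rw [h1, h2]
    -- the inner integral
    have hinner : ∀ V : Fin m × Fin N → ℝ, ∫ w, Z (Ψ.symm (V, w)) =
        if ∀ j, BlockCond η N (Fin.init kv j) (Fin.init ξ j) (rowOf V j) then
          H' (concatBlocks (Fin.init kv) fun j => blockVec (Fin.init kv j) (Fin.init ξ j) (rowOf V j))
        else 0 := by
      intro V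
      by_cases hV : ∀ j, BlockCond η N (Fin.init kv j) (Fin.init ξ j) (rowOf V j)
      · rw [if_pos hV, hH']
        beta_reduce
        set β' : Fin (∑ j : Fin m, Fin.init kv j) → ℝ :=
          concatBlocks (Fin.init kv) fun j => blockVec (Fin.init kv j) (Fin.init ξ j) (rowOf V j)
          with hβ'
        rw [← integral_row_eq_sliceIntegral (hkv _).1 (hkv _).2 η (ξ (Fin.last m))
          (fun v => H (Fin.append β' v ∘ Fin.cast hsum))]
        refine integral_congr_ae (Filter.Eventually.of_forall fun w => ?_)
        -- the concatenated blocks of `Ψ.symm (V, w)` are `(β', last block)`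
        have hconcat : concatBlocks kv (fun j => blockVec (kv j) (ξ j) (rowOf (Ψ.symm (V, w)) j)) =
            Fin.append β' (blockVec (kv (Fin.last m)) (ξ (Fin.last m))
              fun i => if h : i < N then w ⟨i, h⟩ else 0) ∘ Fin.cast hsum := by
          funext t
          obtain ⟨⟨j, i⟩, rfl⟩ := (finSigmaFinEquiv (n := kv)).surjective t
          rw [concatBlocks_apply_equiv]
          simp only [Function.comp_apply]
          induction j using Fin.lastCases with
          | last =>
            rw [hrow_last]
            symm
            refine append_apply_eq_right_of_val β' _ _ i ?_
            simp only [Fin.val_cast, val_finSigmaFinEquiv_last]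
            rfl
          | cast j =>
            rw [hrow_cast]
            symm
            rw [append_apply_eq_left_of_val β' _ _ (finSigmaFinEquiv (n := Fin.init kv) ⟨j, i⟩)
              (by simp only [Fin.val_cast, val_finSigmaFinEquiv_castSucc]), hβ',
              concatBlocks_apply_equiv]
            rfl
        have hcond : (∀ j, BlockCond η N (kv j) (ξ j) (rowOf (Ψ.symm (V, w)) j)) ↔
            BlockCond η N (kv (Fin.last m)) (ξ (Fin.last m)) fun i => if h : i < N then w ⟨i, h⟩ else 0 := by
          rw [Fin.forall_fin_succ']
          simp only [hrow_cast, hrow_last]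
          exact ⟨fun h => h.2, fun h => ⟨hV, h⟩⟩
        simp only [hZ]
        by_cases hw : BlockCond η N (kv (Fin.last m)) (ξ (Fin.last m))
            fun i => if h : i < N then w ⟨i, h⟩ else 0
        · rw [if_pos (hcond.2 hw), if_pos hw, hconcat]
        · rw [if_neg (fun h => hw (hcond.1 h)), if_neg hw]
      · rw [if_neg hV]
        refine integral_eq_zero_of_ae (Filter.Eventually.of_forall fun w => ?_)
        simp only [hZ]
        rw [if_neg]
        · rfl
        · intro h
          apply hV
          intro j
          have := h (Fin.castSucc j)
          rwa [hrow_cast] at this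
    rw [integral_congr_ae (Filter.Eventually.of_forall hinner)]
    -- induction hypothesis for the remaining rows
    rw [flat_eq_multiSlice hη m (Fin.init kv) (fun j => hkv _) (Fin.init ξ) H' hH'm
      (by positivity) hH'b, multiSlice_succ]
    refine multiSlice_congr m _ _ fun β' => ?_
    by_cases hβ' : ∀ t, η ≤ β' t
    · rw [if_pos hβ', hH']
      refine sliceIntegral_congr fun v _ _ => ?_
      have hiff : (∀ t : Fin (bsum (m + 1) kv), η ≤ Fin.append β' v t) ↔ ∀ i, η ≤ v i := by
        constructor
        · intro h i
          have := h (Fin.natAdd (bsum m (Fin.init kv)) i)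
          rwa [Fin.append_right] at this
        · intro h t
          refine Fin.addCases (fun l => ?_) (fun r => ?_) t
          · rw [Fin.append_left]; exact hβ' l
          · rw [Fin.append_right]; exact h r
      by_cases hv : ∀ i, η ≤ v i
      · rw [if_pos hv, if_pos (hiff.2 hv)]
        congr 1
        funext t
        exact append_comp_cast_apply_eq β' v _ _ _ rfl
      · rw [if_neg hv, if_neg (fun h => hv (hiff.1 h))]
    · rw [if_neg hβ']
      symm
      have : ∀ v : Fin (kv (Fin.last m)) → ℝ, ¬ ∀ t : Fin (bsum (m + 1) kv), η ≤ Fin.append β' v t := by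
        intro v h
        apply hβ'
        intro t
        have := h (Fin.castAdd (kv (Fin.last m)) t)
        rwa [Fin.append_left] at this
      simp only [this, if_false]
      exact sliceIntegral_zero _ _

/-! ### The fragmentation operator as an iterated slice integral -/

/-- The block weight `𝓛_{1−γ}(v)/(k! v₁⋯v_k)` is measurable. [folklore] -/
theorem measurable_blockWeight (γ : ℝ) (k : ℕ) : Measurable (blockWeight γ k) := by
  unfold blockWeight
  exact (measurable_linnikFn (1 - γ) Finset.univ).div
    (measurable_const.mul (Finset.measurable_prod _ fun i _ => measurable_pi_apply i))

/-- A bound for the block weight on blocks with entries `≥ η > 0`: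
`|𝓛(v)/(k! ∏ v)| ≤ k (2^k)^k / η^k`. [folklore] -/
theorem abs_blockWeight_le {γ η : ℝ} (hη : 0 < η) (k : ℕ) (v : Fin k → ℝ) (hv : ∀ i, η ≤ v i) :
    |blockWeight γ k v| ≤ k * (2 ^ k) ^ k / η ^ k := by
  unfold blockWeight
  have hprod : η ^ k ≤ ∏ i, v i := by
    calc η ^ k = ∏ _i : Fin k, η := by simp
      _ ≤ ∏ i, v i := Finset.prod_le_prod (fun i _ => hη.le) fun i _ => hv i
  have hpos : 0 < ∏ i, v i := lt_of_lt_of_le (pow_pos hη k) hprod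
  have hfac : (1 : ℝ) ≤ k.factorial := by
    exact_mod_cast Nat.one_le_iff_ne_zero.2 (Nat.factorial_ne_zero k)
  rw [abs_div, abs_mul, Nat.abs_cast, abs_of_pos hpos]
  have hL := abs_linnikFn_le (1 - γ) v Finset.univ
  simp only [Fintype.card_fin] at hL
  rw [div_le_div_iff₀ (by positivity) (pow_pos hη k)]
  calc |Literature.Combinatorics.Enumerative.linnikFn (1 - γ) v Finset.univ| * η ^ k
      ≤ (k * (2 ^ k) ^ k) * η ^ k := mul_le_mul_of_nonneg_right hL (pow_nonneg hη.le k)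
    _ = (k * (2 ^ k) ^ k) * (1 * η ^ k) := by ring
    _ ≤ (k * (2 ^ k) ^ k) * ((k.factorial : ℝ) * ∏ i, v i) :=
        mul_le_mul_of_nonneg_left (mul_le_mul hfac hprod (pow_nonneg hη.le k) (by positivity))
          (by positivity)

/-- **The fragmentation operator as an iterated slice integral** (the printed form (6.3)): for
`g` bounded measurable and `η > 0`,
`fragOp γ η g (ξ) = ξ₁⋯ξ_m ∑_{1 ≤ k_j ≤ N} multiSlice m k ξ (β ↦ 𝟙[β ≥ η] ∏_j w_{k_j}(β_j) g(β))`,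
`w_k(v) = 𝓛_{1−γ}(v)/(k! v₁⋯v_k)`, `β_j` the `j`-th block of `β`, `N = ⌊1/η⌋`.
[cite: FordMaynard2024PrimeSieves, §6.1 (6.3)] -/
theorem fragOp_eq_multiSlice {γ η : ℝ} (hη : 0 < η) (g : VecFn) (hgm : ∀ n, Measurable (g n))
    {F : ℝ} (hF : ∀ n v, |g n v| ≤ F) (m : ℕ) (ξ : Fin m → ℝ) :
    fragOp γ η g m ξ = (∏ j, ξ j) *
      ∑ kv ∈ Fintype.piFinset (fun _ : Fin m => Finset.Icc 1 (maxBlock η)),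
        multiSlice m kv ξ (fun β => if ∀ t, η ≤ β t then
          (∏ j, blockWeight γ (kv j) (fun i =>
              β (Fin.cast (bsum_eq_sum m kv).symm (finSigmaFinEquiv (n := kv) ⟨j, i⟩)))) *
            g (∑ j, kv j) (β ∘ Fin.cast (bsum_eq_sum m kv).symm) else 0) := by
  unfold fragOp
  congr 1
  refine Finset.sum_congr rfl fun kv hkv => ?_
  have hkv' : ∀ j, 1 ≤ kv j ∧ kv j ≤ maxBlock η := fun j => by
    have := Fintype.mem_piFinset.1 hkv j
    simpa using this
  -- the integrand of (6.3) for `kv` as a function of the concatenated blocks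
  set H : (Fin (∑ j, kv j) → ℝ) → ℝ := fun β =>
    (∏ j, blockWeight γ (kv j) (fun i => β (finSigmaFinEquiv (n := kv) ⟨j, i⟩))) *
      g (∑ j, kv j) β with hH
  have hfi : ∀ U : Fin m × Fin (maxBlock η) → ℝ, fragIntegrand γ η (maxBlock η) g kv ξ U =
      if ∀ j, BlockCond η (maxBlock η) (kv j) (ξ j) (rowOf U j) then
        H (concatBlocks kv fun j => blockVec (kv j) (ξ j) (rowOf U j)) else 0 := by
    intro U
    unfold fragIntegrand
    split_ifs with hc
    · simp only [hH, concatBlocks_apply_equiv]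
    · rfl
  simp_rw [hfi]
  have hHm : Measurable H := by
    refine Measurable.mul (Finset.measurable_prod _ fun j _ => (measurable_blockWeight γ (kv j)).comp
      (measurable_pi_iff.2 fun i => measurable_pi_apply _)) (hgm _)
  -- a bound for `H` on vectors with entries `≥ η`
  have hF0 : 0 ≤ F := (abs_nonneg _).trans (hF 0 Fin.elim0)
  set Cw : ℝ := ∏ j, ((kv j : ℝ) * (2 ^ kv j) ^ kv j / η ^ kv j) with hCw
  have hHb : ∀ β : Fin (∑ j, kv j) → ℝ, (∀ t, η ≤ β t) → |H β| ≤ Cw * F := by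
    intro β hβ
    simp only [hH]
    rw [abs_mul, Finset.abs_prod]
    refine mul_le_mul (Finset.prod_le_prod (fun j _ => abs_nonneg _) fun j _ =>
      abs_blockWeight_le hη (kv j) _ fun i => hβ _) (hF _ _) (abs_nonneg _) ?_
    exact Finset.prod_nonneg fun j _ => by positivity
  rw [flat_eq_multiSlice hη m kv hkv' ξ H hHm (by positivity) hHb]
  rfl

end Literature.NumberTheory.Sieve.FordMaynard
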